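import Literature.AlgebraicGeometry.HodgeTheory.MotivatedClassesDeformationLeaves
import Literature.AlgebraicGeometry.HodgeTheory.MotivatedClassesDeformationCurves
import Literature.AlgebraicGeometry.HodgeTheory.SmoothProjectiveCompactificationProofs
import Literature.AlgebraicGeometry.Motives.CurveThroughTwoPointsProofs
import HarnessLib

/-!
# André's deformation theorem (1996, Thm. 0.5): the curve leaf (A0) `Mumford_curveLemma_affine` HOLDS

Family `hodge`, layer `Literature/AlgebraicGeometry/HodgeTheory`. DISCHARGE file for the named fact
`Mumford_curveLemma_affine` (`MotivatedClassesDeformationLeaves.lean`), the curve input (A0) of the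
tree's §5.1 assembly `Andre1996_deformation_holds_of` of André's deformation theorem
`Andre1996_deformation` (Y. André, *Pour une théorie inconditionnelle des motifs*, Publ. Math. IHÉS 83
(1996), Thm. 0.5, proof §5.1 p. 25: "Il existe une variété affine lisse connexe `S'` (par exemple une
courbe) et un morphisme `S' → S` tel que l'image de `S'(ℂ)` dans `S(ℂ)` contienne `s` et `t`";
D. Mumford, *Abelian Varieties*, §6, Lemma, p. 56: any two points of an irreducible variety lie on an
irreducible curve).

The tree already proves the statement in substance, in two accepted pieces that were never joined
under the fact's `_holds` name:

* `Andre1996_deformation_hcurve` (`MotivatedClassesDeformationCurves.lean`) derives the body of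
  `Mumford_curveLemma_affine` VERBATIM from Mumford's two-point lemma in its normalised smooth affine
  form, the named fact `Motives.mumford_smoothCurve_through_two_points` (for `s ≠ t` the smooth
  irreducible affine curve through them, quasi-projective by `IsQuasiProjectiveOver.of_isAffine`; for
  `s = t` the point `Spec ℂ ⟶ S` at `s`);
* `Motives.mumford_smoothCurve_through_two_points_holds` (`Motives/CurveThroughTwoPointsProofs.lean`)
  proves that named fact (a curve through two points by generic hyperplane sections, then
  normalisation: finite, dimension `1`, regular hence smooth over `ℂ`).

This file records the composite as the discharge, exactly as
`SmoothProjectiveCompactificationProofs.lean` does for the sibling leaf (A1)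
`Hironaka1964_smoothCompactification_holds`. No definition, no new named fact, no hypothesis.

## Main result

* `Mumford_curveLemma_affine_holds : Mumford_curveLemma_affine` — PROVED.

## Consequence for `Andre1996_deformation`

With (A0) (this file) and (A1) (`Hironaka1964_smoothCompactification_holds`) discharged, the
assembly `Andre1996_deformation_holds_of` leaves André's Thm. 0.5 conditional on exactly three
existing named facts of the tree: (A2) `deligne_globalInvariantCycles`, (A3)
`Andre1996_exists_motivated_of_motivated_pullback`, (A5) `Andre1996_motivatedClasses_pullback` —
`Andre1996_deformation_of_three_leaves` below (the Literature-side form of the Summit-side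
`Theorems.andreDeformation_of_three_leaves`; (A5) is discharged Summit-side,
`Theorems.Andre1996_motivatedClasses_pullback_holds`, which a Literature file may not import).

## References

* [Andre1996Motifs] Y. André, Pour une théorie inconditionnelle des motifs, Publ. Math. IHÉS 83
  (1996): Thm. 0.5 (p. 8), §5.1 (p. 25).
* [MumfordAV1970] D. Mumford, Abelian Varieties, Oxford University Press 1970, §6, Lemma (p. 56).
* [Liu2002] Q. Liu, Algebraic Geometry and Arithmetic Curves, OUP 2002: Prop. 2.5.10, Cor. 4.1.30,
  Ex. 4.2.9, Cor. 4.3.33 (normalisation of a curve).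
-/

noncomputable section

open CategoryTheory AlgebraicGeometry

namespace Literature.AlgebraicGeometry.HodgeTheory

/-- DISCHARGE of the named fact `Mumford_curveLemma_affine` (`MotivatedClassesDeformationLeaves.lean`:
the curve lemma on an affine variety — Mumford, *Abelian Varieties*, §6, Lemma (p. 56), in the
normalised smooth quasi-projective shape consumed by André 1996 §5.1): the tree's derivation
`Andre1996_deformation_hcurve` of exactly this statement from Mumford's two-point lemma
`Motives.mumford_smoothCurve_through_two_points`, applied to the tree's proof
`Motives.mumford_smoothCurve_through_two_points_holds` of that lemma.
[cite: MumfordAV1970, §6 Lemma (p. 56)] [cite: Andre1996Motifs, §5.1 (p. 25)] -/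
theorem Mumford_curveLemma_affine_holds : Mumford_curveLemma_affine :=
  fun S hS hft Z hZc hZ s t hs ht =>
    Andre1996_deformation_hcurve Motives.mumford_smoothCurve_through_two_points_holds S hS hft Z hZc hZ
      s t hs ht

/-- **André's deformation theorem (Thm. 0.5) from its three remaining leaves.** The §5.1 assembly
`Andre1996_deformation_holds_of` with its curve input (A0) discharged by
`Mumford_curveLemma_affine_holds` and its compactification input (A1) by
`Hironaka1964_smoothCompactification_holds`; the remaining hypotheses are the tree's existing named
facts (A2) `deligne_globalInvariantCycles` (Deligne, théorème de la partie fixe), (A3)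
`Andre1996_exists_motivated_of_motivated_pullback` (André's Thm. 0.4 in its §5.1 form) and (A5)
`Andre1996_motivatedClasses_pullback` (André's Prop. 2.1 (ii)), taken verbatim.
[cite: Andre1996Motifs, Thm. 0.5 (p. 8) and §5.1 (p. 25)] [cite: MumfordAV1970, §6 Lemma (p. 56)]
[cite: Hironaka1964, Main Theorem I] -/
theorem Andre1996_deformation_of_three_leaves (hD : deligne_globalInvariantCycles)
    (h04 : Andre1996_exists_motivated_of_motivated_pullback)
    (h21 : Andre1996_motivatedClasses_pullback) : Andre1996_deformation :=
  Andre1996_deformation_holds_of Mumford_curveLemma_affine_holds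
    Hironaka1964_smoothCompactification_holds hD h04 h21

end Literature.AlgebraicGeometry.HodgeTheory

end
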